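import Literature.Probability.Percolation.ZdLowestFrontier
import Literature.Probability.Percolation.RSWLemma
import HarnessLib

/-!
# Feet of the lowest crossing: the mixed crossing lemma, pivotal vertices, Nolin's fifth arm

Topic `Literature/Probability/Percolation`; bond percolation on `ℤ²`. PROOFS ONLY (no definition,
no named fact). Second file of the bond-`ℤ²` rendering of Nolin's construction of a five-arm
vertex on the lowest crossing (P. Nolin, EJP 13 (2008), §5.2, proof of Thm. 24 (ii)
[arXiv 0711.4948: Thm. 23 (ii), p. 17]; the site-`𝕋` twin is `FiveArmSite.lean`), on top of
`ZdLowestFrontier.lean` (the region `dualBelowR` below the lowest crossing `π` of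
`R = [0,M] × [0,N]`, above faces and vertices, attachments `IsAttachedLow`, dual feet
`HasDualFootAt`, the auxiliary configuration `footConfig`):

* `exists_mem_support_of_mixedCrossing` — **the mixed crossing lemma**: a left–right lattice
  walk of `R` meets every "tentacle" made of a lattice walk from the top side to a vertex `p`
  continued by a walk of faces from a face around `p` down to the bottom face row that crosses no
  edge of the left–right walk (winding numbers of `extendRight`, as in `PlanarDuality.lean`);
* `mem_support_of_hasDualFootAt` — a vertex of the lowest crossing with a dual foot lies on every
  open left–right walk (it is pivotal);
* `hasDualFootAt_of_dualTBCrossing` — a dual top–bottom crossing of `footConfig M N ω v` yields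
  a dual foot at `v`;
* `hasDualFootAt_of_gap` — **Nolin's fifth arm**: on the lowest crossing, the last attachment
  before a dual foot has a dual foot ("consider the last vertex `v` before `v₂` that is connected
  to the top side: it is not hard to see that there is a white arm from `v` to the top side");
* `exists_doubleFoot` — hence between an attachment and a dual foot (in either order along `π`)
  some vertex of `π` has both: three open arms (the two halves of `π`, the attachment) and, being
  pivotal, two closed dual arms — the five-arm vertex.

## References

* P. Nolin, Near-critical percolation in two dimensions, *Electron. J. Probab.* 13 (2008)
  1562–1623, §5.2, proof of Thm. 24 (ii) (arXiv 0711.4948: Thm. 23 (ii), p. 17) [Nolin2008].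
* H. Kesten, *Percolation theory for mathematicians*, Birkhäuser (1982), §2.2–2.3 [KestenPTM1982].
* W. Werner, *Lectures on two-dimensional critical percolation*, PCMI (2009), Lecture 6, §3
  [WernerPCMI2009].

## Tree

`ZdLowestFrontier.lean`; `extendRight`, `walkWinding_eq_of_walk`, `walkWinding_eq_of_faceWalk`,
`walkWinding_extendRight_top/bottom`, `exists_dart_sepEdge_mem_edges`,
`lrCrossing_xor_dualTBCrossing_holds` (`PlanarDuality.lean`); `exists_prefix_first_mem`
(`RSWLemma.lean`); `cornerFaces`, `mem_sepEdge_of_cornerFaces` (`ZdFiveArmUniqueness.lean`).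
-/

noncomputable section

open SimpleGraph Finset

namespace Literature.Probability.Percolation

open LatticeModels

variable {M N : ℕ} {ω : BondConfig (Site 2)}

/-! ### Edges of the extended crossing -/

/-- Edges of `extendRight P B`: those of `P`, the step `{b, b + e₀}`, or an edge with both
endpoints on the column `x₀ = b₀ + 1`. [folklore] -/
theorem mem_edges_extendRight_cases {a b : Site 2} {P : (zdGraph 2).Walk a b} {B : ℤ} {e : Sym2 (Site 2)}
    (he : e ∈ (extendRight P B).edges) :
    e ∈ P.edges ∨ e = s(b, b + Pi.single 0 1) ∨ ∀ w ∈ e, w 0 = b 0 + 1 := by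
  rw [extendRight, Walk.edges_append, List.mem_append, Walk.edges_cons, List.mem_cons] at he
  rcases he with he | rfl | he
  · exact Or.inl he
  · exact Or.inr (Or.inl rfl)
  · right; right
    intro w hw
    induction e using Sym2.ind with
    | h x y =>
      have hx := mem_support_downRun.1 (Walk.fst_mem_support_of_mem_edges _ he)
      have hy := mem_support_downRun.1 (Walk.snd_mem_support_of_mem_edges _ he)
      rcases Sym2.mem_iff.1 hw with rfl | rfl
      · simpa using hx.1
      · simpa using hy.1

/-! ### The mixed crossing lemma -/

/-- **The mixed crossing lemma.** Let `P` be a lattice walk of `R = [0,M] × [0,N]` from the left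
side to the right side, `U` a lattice walk of `R` from the top side to a vertex `p`, and `D` a walk
of faces of the dual rectangle `R* = [0,M-1] × [-1,N]` from a face `g ∈ R*` around `p` to the
bottom face row, no step of which crosses an edge of `P`. Then `P` and `U` have a common vertex.
(The curve `U`, then the segment from `p` into the face `g`, then `D`, joins the top to the bottom
of `R`; a left–right crossing avoiding the vertices of `U` — hence `p` — and the edges crossed by
`D` cannot exist. Proof by winding numbers of `extendRight P 0`, as for
`exists_mem_support_of_crossing` and `exists_dart_sepEdge_mem_edges`; Kesten 1982, §2.2.) [cite: KestenPTM1982, §2.2 (paths crossing a rectangle must intersect)] -/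
theorem exists_mem_support_of_mixedCrossing {a b c p g s : Site 2}
    (P : (zdGraph 2).Walk a b) (U : (zdGraph 2).Walk c p) (D : (zdGraph 2).Walk g s)
    (hP : ∀ z ∈ P.support, 0 ≤ z 0 ∧ z 0 ≤ M ∧ 0 ≤ z 1 ∧ z 1 ≤ N)
    (hU : ∀ z ∈ U.support, 0 ≤ z 0 ∧ z 0 ≤ M ∧ 0 ≤ z 1 ∧ z 1 ≤ N)
    (hD : ∀ z ∈ D.support, 0 ≤ z 0 ∧ z 0 + 1 ≤ M ∧ -1 ≤ z 1 ∧ z 1 ≤ N)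
    (ha : a 0 = 0) (hb : b 0 = M) (hc : c 1 = N) (hg : g ∈ cornerFaces p) (hs : s 1 = -1)
    (hDP : ∀ d ∈ D.darts, sepEdge d.fst d.snd ∉ P.edges) :
    ∃ z ∈ P.support, z ∈ U.support := by
  by_contra hdis
  push Not at hdis
  have hp : p ∉ P.support := fun h => hdis p h U.end_mem_support
  have hbN := hP b P.end_mem_support
  have hpR := hU p U.end_mem_support
  have hgR := hD g D.start_mem_support
  have hP' : ∀ z ∈ P.support, (0 : ℤ) ≤ z 1 ∧ z 1 ≤ N := fun z hz => ⟨(hP z hz).2.2.1, (hP z hz).2.2.2⟩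
  set W := extendRight P 0 with hW
  have hend := extendRight_end_apply b hbN.2.2.1
  -- no edge at `p` lies on the extended crossing
  have hedge : ∀ e ∈ W.edges, p ∉ e := by
    intro e he hpe
    rcases mem_edges_extendRight_cases he with he | rfl | he
    · apply hp
      induction e using Sym2.ind with
      | h x y =>
        rcases Sym2.mem_iff.1 hpe with rfl | rfl
        · exact P.fst_mem_support_of_mem_edges he
        · exact P.snd_mem_support_of_mem_edges he
    · rcases Sym2.mem_iff.1 hpe with rfl | rfl
      · exact hp P.end_mem_support
      · simp at hpR; omega
    · have := he p hpe; omega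
  -- (1) winding `0` at the top end `c` of `U`, constant along `U`, hence `0` at `p`
  have hWc : walkWinding W c = 0 := walkWinding_extendRight_top hP' hc
  have hWp : walkWinding W p = 0 := by
    have h : walkWinding W c = walkWinding W p := walkWinding_eq_of_walk W U ?_ ?_ ?_
    · rw [← h]; exact hWc
    · intro z hz hzW
      rcases mem_support_extendRight hbN.2.2.1 hzW with hzP | hzP
      · exact hdis z hzP hz
      · have := (hU z hz).2.1; omega
    · intro z hz
      simp only [mem_rayAbove, ha, not_and, not_le]
      intro _; have := (hU z hz).1; omega
    · intro z hz
      simp only [mem_rayAbove, not_and]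
      intro h1; exfalso
      rw [hend.2] at h1
      have := (hU z hz).2.2.1; omega
  -- (2) from the face `p` (north-east of `p`) to the face `g`, around `p`
  have hWg : walkWinding W g = 0 := by
    -- a face walk from `p` to `g` through faces around `p` with first coordinate `≥ 0`
    obtain ⟨J, hJs, hJx⟩ : ∃ J : (zdGraph 2).Walk p g, (∀ z ∈ J.support, z ∈ cornerFaces p) ∧
        ∀ z ∈ J.support, 0 ≤ z 0 := by
      rcases eq_of_mem_cornerFaces hg with rfl | rfl | rfl | rfl
      · exact ⟨Walk.nil, by simp [ZdCorner.NE_mem], by simp; omega⟩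
      · refine ⟨Walk.cons (ZdCorner.adj_NE_NW _) Walk.nil, ?_, ?_⟩
        · intro z hz; simp at hz; rcases hz with rfl | rfl
          · exact ZdCorner.NE_mem _
          · exact ZdCorner.NW_mem _
        · intro z hz; simp at hz; rcases hz with rfl | rfl
          · omega
          · simp at hgR ⊢; omega
      · refine ⟨Walk.cons (ZdCorner.adj_NE_SE _) Walk.nil, ?_, ?_⟩
        · intro z hz; simp at hz; rcases hz with rfl | rfl
          · exact ZdCorner.NE_mem _
          · exact ZdCorner.SE_mem _
        · intro z hz; simp at hz; rcases hz with rfl | rfl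
          · omega
          · simp; omega
      · refine ⟨Walk.cons (ZdCorner.adj_NE_SE _) (Walk.cons (ZdCorner.adj_SE_SW _) Walk.nil), ?_, ?_⟩
        · intro z hz; simp at hz; rcases hz with rfl | rfl | rfl
          · exact ZdCorner.NE_mem _
          · exact ZdCorner.SE_mem _
          · exact ZdCorner.SW_mem _
        · intro z hz; simp at hz
          simp only [Pi.sub_apply, single_zero_apply_zero, single_one_apply_zero] at hgR
          rcases hz with rfl | rfl | rfl
          · omega
          · simp; omega
          · simp; omega
    have h : walkWinding W p = walkWinding W g := walkWinding_eq_of_faceWalk W J ?_ ?_ ?_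
    · rw [← h]; exact hWp
    · intro dq hdq he
      exact hedge _ he (mem_sepEdge_of_cornerFaces (hJs _ (J.dart_fst_mem_support_of_mem_darts hdq))
        (hJs _ (J.dart_snd_mem_support_of_mem_darts hdq)) dq.adj)
    · intro z hz
      simp only [mem_rayAbove, ha, not_and, not_le]
      intro _; have := hJx z hz; omega
    · intro z hz
      simp only [mem_rayAbove, not_and]
      intro h1; exfalso
      rw [hend.2] at h1
      have := (hJs z hz).2
      omega
  -- (3) constant along `D`, hence `0` at the bottom face `s`; but it is `-1` there
  have hWs : walkWinding W s = -1 :=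
    walkWinding_extendRight_bottom hP' (by rw [hs]; ring) (by rw [hb]; have := (hD s D.end_mem_support).2.1; omega)
  have hconst := walkWinding_eq_of_faceWalk W D ?_ ?_ ?_
  · rw [hWg, hWs] at hconst; exact absurd hconst (by norm_num)
  · intro dq hdq he
    have hz := hD _ (D.dart_fst_mem_support_of_mem_darts hdq)
    have hz' := hD _ (D.dart_snd_mem_support_of_mem_darts hdq)
    have hxle : ∀ w ∈ sepEdge dq.fst dq.snd, w 0 ≤ M := by
      intro w hw
      have := (sepEdge_apply_zero_le hw).1
      rcases le_total (dq.toProd.1 0) (dq.toProd.2 0) with h | h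
      · rw [max_eq_right h] at this; omega
      · rw [max_eq_left h] at this; omega
    rcases mem_edges_extendRight_cases he with he | heq | he
    · exact hDP dq hdq he
    · have := hxle (b + Pi.single 0 1) (by rw [heq]; exact Sym2.mem_mk_right _ _)
      simp at this; omega
    · have := he (sepLo dq.fst dq.snd) (by rw [sepEdge]; exact Sym2.mem_mk_left _ _)
      have := hxle (sepLo dq.fst dq.snd) (by rw [sepEdge]; exact Sym2.mem_mk_left _ _)
      omega
  · intro z hz
    simp only [mem_rayAbove, ha, not_and, not_le]
    intro _; have := (hD z hz).1; omega
  · intro z hz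
    simp only [mem_rayAbove, not_and]
    intro h1; exfalso
    rw [hend.2] at h1
    have := (hD z hz).2.2.1; omega

/-! ### Oriented variants: the left–right walk may run from either side -/

/-- `exists_dart_sepEdge_mem_edges` for a left–right walk given in either orientation. [folklore] -/
theorem exists_dart_sepEdge_mem_edges_of_ends {a b t s : Site 2}
    (P : (zdGraph 2).Walk a b) (Q : (zdGraph 2).Walk t s)
    (hP : ∀ z ∈ P.support, 0 ≤ z 0 ∧ z 0 ≤ M ∧ 0 ≤ z 1 ∧ z 1 ≤ N)
    (hQ : ∀ z ∈ Q.support, 0 ≤ z 0 ∧ z 0 + 1 ≤ M ∧ -1 ≤ z 1 ∧ z 1 ≤ N)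
    (hends : (a 0 = 0 ∧ b 0 = M) ∨ (a 0 = M ∧ b 0 = 0)) (ht : t 1 = N) (hs : s 1 = -1) :
    ∃ dq ∈ Q.darts, sepEdge dq.fst dq.snd ∈ P.edges := by
  rcases hends with ⟨ha, hb⟩ | ⟨ha, hb⟩
  · exact exists_dart_sepEdge_mem_edges P Q hP hQ ha hb ht hs
  · obtain ⟨dq, hdq, he⟩ := exists_dart_sepEdge_mem_edges P.reverse Q
      (fun z hz => hP z (by simpa using hz)) hQ hb ha ht hs
    exact ⟨dq, hdq, by simpa using he⟩

/-- `exists_mem_support_of_mixedCrossing` for a left–right walk given in either orientation.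
[folklore] -/
theorem exists_mem_support_of_mixedCrossing_of_ends {a b c p g s : Site 2}
    (P : (zdGraph 2).Walk a b) (U : (zdGraph 2).Walk c p) (D : (zdGraph 2).Walk g s)
    (hP : ∀ z ∈ P.support, 0 ≤ z 0 ∧ z 0 ≤ M ∧ 0 ≤ z 1 ∧ z 1 ≤ N)
    (hU : ∀ z ∈ U.support, 0 ≤ z 0 ∧ z 0 ≤ M ∧ 0 ≤ z 1 ∧ z 1 ≤ N)
    (hD : ∀ z ∈ D.support, 0 ≤ z 0 ∧ z 0 + 1 ≤ M ∧ -1 ≤ z 1 ∧ z 1 ≤ N)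
    (hends : (a 0 = 0 ∧ b 0 = M) ∨ (a 0 = M ∧ b 0 = 0)) (hc : c 1 = N) (hg : g ∈ cornerFaces p)
    (hs : s 1 = -1) (hDP : ∀ d ∈ D.darts, sepEdge d.fst d.snd ∉ P.edges) :
    ∃ z ∈ P.support, z ∈ U.support := by
  rcases hends with ⟨ha, hb⟩ | ⟨ha, hb⟩
  · exact exists_mem_support_of_mixedCrossing P U D hP hU hD ha hb hc hg hs hDP
  · obtain ⟨z, hz, hzU⟩ := exists_mem_support_of_mixedCrossing P.reverse U D
      (fun z hz => hP z (by simpa using hz)) hU hD hb ha hc hg hs (fun d hd => by simpa using hDP d hd)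
    exact ⟨z, by simpa using hz, hzU⟩

/-! ### Faces around an interior vertex; corner walks -/

/-- The faces around a vertex of `R` with `1 ≤ v₀ ≤ M - 1` lie in `R*`. [folklore] -/
theorem mem_dualRectangle_of_cornerFaces {v z : Site 2} (hv : v ∈ rectangle M N) (hv0 : 1 ≤ v 0)
    (hvM : v 0 + 1 ≤ M) (hz : z ∈ cornerFaces v) : z ∈ dualRectangle M N := by
  have := mem_rectangle_iff.1 hv
  obtain ⟨h0, h1⟩ := hz
  rw [mem_dualRectangle_iff]
  omega

/-- **A corner walk inside `R*`**: two faces of `R*` around a vertex `v ∈ R` are joined by a walk of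
faces of `R*` around `v` (the faces of `R*` around `v` form an arc of the 4-cycle around `v`).
[folklore] -/
theorem exists_cornerWalk_mem_dualRectangle {v f g : Site 2} (hv : v ∈ rectangle M N)
    (hf : f ∈ cornerFaces v) (hfR : f ∈ dualRectangle M N) (hg : g ∈ cornerFaces v)
    (hgR : g ∈ dualRectangle M N) :
    ∃ J : (zdGraph 2).Walk f g, ∀ z ∈ J.support, z ∈ cornerFaces v ∧ z ∈ dualRectangle M N := by
  have hvR := mem_rectangle_iff.1 hv
  have hfR' := mem_dualRectangle_iff.1 hfR
  have hgR' := mem_dualRectangle_iff.1 hgR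
  -- membership of the four faces in `R*`, in coordinates
  have hNE : v 0 ≤ (M : ℤ) - 1 → v ∈ dualRectangle M N := fun h => by
    rw [mem_dualRectangle_iff]; omega
  have hNW : 1 ≤ v 0 → v - Pi.single 0 1 ∈ dualRectangle M N := fun h => by
    simp only [mem_dualRectangle_iff, Pi.sub_apply, single_zero_apply_zero, single_zero_apply_one]; omega
  have hSE : v 0 ≤ (M : ℤ) - 1 → v - Pi.single 1 1 ∈ dualRectangle M N := fun h => by
    simp only [mem_dualRectangle_iff, Pi.sub_apply, single_one_apply_zero, single_one_apply_one]; omega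
  -- one- and two-step walks
  have one : ∀ {x y : Site 2}, (zdGraph 2).Adj x y → x ∈ cornerFaces v → x ∈ dualRectangle M N →
      y ∈ cornerFaces v → y ∈ dualRectangle M N →
      ∃ J : (zdGraph 2).Walk x y, ∀ z ∈ J.support, z ∈ cornerFaces v ∧ z ∈ dualRectangle M N := by
    intro x y hxy hx hxR hy hyR
    refine ⟨Walk.cons hxy Walk.nil, fun z hz => ?_⟩
    simp at hz
    rcases hz with rfl | rfl
    exacts [⟨hx, hxR⟩, ⟨hy, hyR⟩]
  have two : ∀ {x m y : Site 2}, (zdGraph 2).Adj x m → (zdGraph 2).Adj m y → x ∈ cornerFaces v →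
      x ∈ dualRectangle M N → m ∈ cornerFaces v → m ∈ dualRectangle M N → y ∈ cornerFaces v →
      y ∈ dualRectangle M N →
      ∃ J : (zdGraph 2).Walk x y, ∀ z ∈ J.support, z ∈ cornerFaces v ∧ z ∈ dualRectangle M N := by
    intro x m y hxm hmy hx hxR hm hmR hy hyR
    refine ⟨Walk.cons hxm (Walk.cons hmy Walk.nil), fun z hz => ?_⟩
    simp at hz
    rcases hz with rfl | rfl | rfl
    exacts [⟨hx, hxR⟩, ⟨hm, hmR⟩, ⟨hy, hyR⟩]
  rcases eq_of_mem_cornerFaces hf with rfl | rfl | rfl | rfl <;>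
    rcases eq_of_mem_cornerFaces hg with rfl | rfl | rfl | rfl
  -- f = NE
  · exact ⟨Walk.nil, fun z hz => by simp at hz; subst hz; exact ⟨hf, hfR⟩⟩
  · exact one (ZdCorner.adj_NE_NW _) hf hfR hg hgR
  · exact one (ZdCorner.adj_NE_SE _) hf hfR hg hgR
  · simp only [Pi.sub_apply, single_zero_apply_zero, single_one_apply_zero] at hgR'
    exact two (ZdCorner.adj_NE_NW _) (ZdCorner.adj_NW_SW _) hf hfR (ZdCorner.NW_mem _) (hNW (by omega)) hg hgR
  -- f = NW
  · exact one (ZdCorner.adj_NE_NW _).symm hf hfR hg hgR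
  · exact ⟨Walk.nil, fun z hz => by simp at hz; subst hz; exact ⟨hf, hfR⟩⟩
  · simp only [Pi.sub_apply, single_one_apply_zero] at hgR'
    exact two (ZdCorner.adj_NE_NW _).symm (ZdCorner.adj_NE_SE _) hf hfR (ZdCorner.NE_mem _) (hNE (by omega)) hg hgR
  · exact one (ZdCorner.adj_NW_SW _) hf hfR hg hgR
  -- f = SE
  · exact one (ZdCorner.adj_NE_SE _).symm hf hfR hg hgR
  · simp only [Pi.sub_apply, single_one_apply_zero] at hfR'
    exact two (ZdCorner.adj_NE_SE _).symm (ZdCorner.adj_NE_NW _) hf hfR (ZdCorner.NE_mem _) (hNE (by omega)) hg hgR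
  · exact ⟨Walk.nil, fun z hz => by simp at hz; subst hz; exact ⟨hf, hfR⟩⟩
  · exact one (ZdCorner.adj_SE_SW _) hf hfR hg hgR
  -- f = SW
  · simp only [Pi.sub_apply, single_zero_apply_zero, single_one_apply_zero] at hfR'
    exact two (ZdCorner.adj_NW_SW _).symm (ZdCorner.adj_NE_NW _).symm hf hfR (ZdCorner.NW_mem _) (hNW (by omega)) hg hgR
  · exact one (ZdCorner.adj_NW_SW _).symm hf hfR hg hgR
  · exact one (ZdCorner.adj_SE_SW _).symm hf hfR hg hgR
  · exact ⟨Walk.nil, fun z hz => by simp at hz; subst hz; exact ⟨hf, hfR⟩⟩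

/-! ### A dual foot makes the vertex unavoidable for open left–right crossings -/

/-- **A vertex of the lowest crossing with a dual foot lies on every open left–right walk of
`R`** (it is pivotal): the dual walk "top face row → face around `v` → around `v` → face below at
`v` → bottom face row" crosses an edge of the walk (`exists_dart_sepEdge_mem_edges`), and its only
steps across open edges are those around `v`. [cite: KestenPTM1982, §2.2 (paths crossing a rectangle must intersect)] -/
theorem mem_support_of_hasDualFootAt {a b : Site 2}
    (P : (zdGraph 2).Walk a b) (hP : ∀ z ∈ P.support, z ∈ rectangle M N)
    (hends : (a 0 = 0 ∧ b 0 = M) ∨ (a 0 = M ∧ b 0 = 0)) (hPω : ∀ e ∈ P.edges, e ∈ ω)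
    {v : Site 2} (hv : IsLowVertex M N ω v) (hvR : v ∈ rectangle M N)
    (hfoot : HasDualFootAt M N ω v) : v ∈ P.support := by
  classical
  obtain ⟨t, ht, f, hf, hconn⟩ := hfoot
  obtain ⟨Q₁, hQ₁s, hQ₁e⟩ :=
    exists_walk_of_mem_openConnIn (fun _ h => h.1 : dualConfig ω ⊆ (zdGraph 2).edgeSet) hconn
  obtain ⟨g, hg, hgB⟩ := hv.exists_cornerFace_mem
  obtain ⟨b', hb', hconn₃⟩ := exists_openConnIn_dualBelowR hgB
  obtain ⟨Q₃, hQ₃s, hQ₃e⟩ :=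
    exists_walk_of_mem_openConnIn (fun _ h => h.1 : dualConfig ω ⊆ (zdGraph 2).edgeSet) hconn₃
  obtain ⟨J, hJ⟩ := exists_cornerWalk_mem_dualRectangle hvR hf (hQ₁s f Q₁.end_mem_support) hg
    (dualBelowR_subset hgB)
  set Q : (zdGraph 2).Walk t b' := Q₁.append (J.append Q₃.reverse) with hQ
  have ht1 : t 1 = N := (Finset.mem_filter.1 ht).2
  have hb'1 : b' 1 = -1 := (Finset.mem_filter.1 hb').2
  have hQs : ∀ z ∈ Q.support, 0 ≤ z 0 ∧ z 0 + 1 ≤ M ∧ -1 ≤ z 1 ∧ z 1 ≤ N := by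
    intro z hz
    have hzR : z ∈ dualRectangle M N := by
      rw [hQ, Walk.mem_support_append_iff, Walk.mem_support_append_iff, Walk.support_reverse,
        List.mem_reverse] at hz
      rcases hz with hz | hz | hz
      · exact hQ₁s z hz
      · exact (hJ z hz).2
      · exact dualBelowR_subset (Finset.mem_coe.1 (hQ₃s z hz))
    have := mem_dualRectangle_iff.1 hzR
    omega
  have hP' : ∀ z ∈ P.support, 0 ≤ z 0 ∧ z 0 ≤ M ∧ 0 ≤ z 1 ∧ z 1 ≤ N := fun z hz =>
    mem_rectangle_iff.1 (hP z hz)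
  obtain ⟨dq, hdq, hdqP⟩ := exists_dart_sepEdge_mem_edges_of_ends P Q hP' hQs hends ht1 hb'1
  have hopen : sepEdge dq.fst dq.snd ∈ ω := hPω _ hdqP
  rw [hQ, Walk.darts_append, List.mem_append, Walk.darts_append, List.mem_append, Walk.darts_reverse,
    List.mem_reverse, List.mem_map] at hdq
  rcases hdq with hdq | hdq | ⟨d₃, hd₃, rfl⟩
  · exact absurd hopen (ZdDual.sepEdge_not_mem_of_mem_dualConfig dq.adj
      (hQ₁e _ (by rw [Walk.edges]; exact List.mem_map.2 ⟨dq, hdq, rfl⟩)))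
  · have hvmem : v ∈ sepEdge dq.fst dq.snd :=
      mem_sepEdge_of_cornerFaces (hJ _ (J.dart_fst_mem_support_of_mem_darts hdq)).1
        (hJ _ (J.dart_snd_mem_support_of_mem_darts hdq)).1 dq.adj
    rw [sepEdge] at hvmem hdqP
    rcases Sym2.mem_iff.1 hvmem with h | h
    · rw [h]; exact P.fst_mem_support_of_mem_edges hdqP
    · rw [h]; exact P.snd_mem_support_of_mem_edges hdqP
  · have : sepEdge d₃.snd d₃.fst ∉ ω := by
      rw [sepEdge_comm]
      exact ZdDual.sepEdge_not_mem_of_mem_dualConfig d₃.adj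
        (hQ₃e _ (by rw [Walk.edges]; exact List.mem_map.2 ⟨d₃, hd₃, rfl⟩))
    exact absurd hopen this

/-! ### The fifth arm from a dual crossing of `footConfig` -/

/-- **A dual top–bottom crossing of `footConfig M N ω v` yields a dual foot at `v`**: follow it
from the top face row; before it reaches a face around `v` it runs through above faces across
closed edges (an edge it crosses there has an above face beside it and is not at `v`, so it lies
outside `footConfig` only by being closed), and it cannot leave the above faces otherwise (the
boundary of the region below is open). [folklore] -/
theorem hasDualFootAt_of_dualTBCrossing (hω : ω ⊆ (zdGraph 2).edgeSet)
    (hT : ∀ t ∈ dualTopSide M N, t ∉ dualBelowR M N ω) {v : Site 2}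
    (h : footConfig M N ω v ∈ dualTBCrossing M N) : HasDualFootAt M N ω v := by
  classical
  obtain ⟨t, ht, s, hs, hconn⟩ := (mem_openCrossing_iff.1 h :)
  have ht' : t ∈ dualTopSide M N := Finset.mem_coe.1 ht
  have hs' : s ∈ dualBottomSide M N := Finset.mem_coe.1 hs
  obtain ⟨Q, hQs, hQe⟩ :=
    exists_walk_of_mem_openConnIn (fun _ h => h.1 : dualConfig (footConfig M N ω v) ⊆ (zdGraph 2).edgeSet) hconn
  have hta : IsAboveFace M N ω t := isAboveFace_of_mem_dualTopSide ht' (hT t ht')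
  -- the set to be reached: faces around `v`, or faces that are not above
  set O : Set (Site 2) := {z | z ∈ cornerFaces v ∨ ¬ IsAboveFace M N ω z} with hO
  by_cases htc : t ∈ cornerFaces v
  · exact ⟨t, ht', t, htc, openConnIn_refl (Finset.mem_coe.2 (Finset.mem_filter.1 ht').1)⟩
  have htO : t ∉ O := by rintro (h | h); exacts [htc h, h hta]
  have hsO : s ∈ O := Or.inr fun hsa => hsa.not_mem_dualBelowR (mem_dualBelowR_of_mem_dualBottomSide hs')
  -- the prefix of `Q` up to its first face in `O`
  obtain ⟨v', hv'O, q, hqs, hqe, hqd⟩ :=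
    exists_prefix_first_mem (O := O) Q ⟨s, Q.end_mem_support, hsO⟩
  have hstep' : ∀ d ∈ q.darts, s(d.fst, d.snd) ∈ dualConfig ω := by
    intro d hd
    have hda : IsAboveFace M N ω d.fst := by
      by_contra h'; exact hqd d hd (Or.inr h')
    have hdual : s(d.fst, d.snd) ∈ dualConfig (footConfig M N ω v) :=
      hQe _ (hqe _ (by rw [Walk.edges]; exact List.mem_map.2 ⟨d, hd, rfl⟩))
    have hnot : sepEdge d.fst d.snd ∉ footConfig M N ω v := ZdDual.sepEdge_not_mem_of_mem_dualConfig d.adj hdual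
    rw [mem_dualConfig_mk_iff hω d.adj]
    intro he
    apply hnot
    refine ⟨he, ⟨d.fst, ?_, hda⟩, fun hv => hqd d hd (Or.inl (cornerFaces_of_mem_sepEdge d.adj hv).1)⟩
    rw [dualEdge_sepEdge d.adj]
    exact Sym2.mem_mk_left _ _
  have hqω : ∀ e ∈ q.edges, e ∈ dualConfig ω := by
    intro e he
    rw [Walk.edges, List.mem_map] at he
    obtain ⟨d, hd, rfl⟩ := he
    exact hstep' d hd
  rcases hv'O with hcorner | hna
  · exact ⟨t, ht', v', hcorner, mem_openConnIn_of_walk q (fun z hz => hQs z (hqs z hz)) hqω⟩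
  · -- `v'` not above: impossible, the boundary of the region below is open
    exfalso
    have hnil : ¬ q.Nil := by
      intro hn
      exact htO (hn.eq ▸ Or.inr hna)
    obtain ⟨e, he, hv'e⟩ := (Walk.mem_support_iff_exists_mem_edges_of_not_nil hnil).1 q.end_mem_support
    -- the other endpoint `u` of `e` starts a dart of `q`, hence lies outside `O`: it is above
    obtain ⟨u, hue, huv'⟩ : ∃ u ∈ e, (zdGraph 2).Adj u v' := by
      induction e using Sym2.ind with
      | h x y =>
        have hadj := q.adj_of_mem_edges he
        rcases Sym2.mem_iff.1 hv'e with rfl | rfl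
        · exact ⟨y, Sym2.mem_mk_right _ _, hadj.symm⟩
        · exact ⟨x, Sym2.mem_mk_left _ _, hadj⟩
    have heq : e = s(u, v') := by
      induction e using Sym2.ind with
      | h x y =>
        rcases Sym2.mem_iff.1 hue with rfl | rfl <;> rcases Sym2.mem_iff.1 hv'e with h | h
        · exact absurd h huv'.ne.symm
        · rw [h]
        · rw [h, Sym2.eq_swap]
        · exact absurd h huv'.ne.symm
    have huO : u ∉ O := by
      have hus : u ∈ q.support := by
        rcases Sym2.mem_iff.1 (heq ▸ hue : u ∈ s(u, v')) with h | h
        · exact q.fst_mem_support_of_mem_edges (heq ▸ he)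
        · exact q.fst_mem_support_of_mem_edges (heq ▸ he)
      have : u ∈ q.darts.map (·.fst) ∨ u = v' := by
        have h := q.map_fst_darts_append
        rw [← h, List.mem_append, List.mem_singleton] at hus
        exact hus
      rcases this with h | h
      · obtain ⟨d, hd, rfl⟩ := List.mem_map.1 h
        exact hqd d hd
      · exact absurd h huv'.ne
    have hua : IsAboveFace M N ω u := by
      by_contra h'; exact huO (Or.inr h')
    have hdual : s(u, v') ∈ dualConfig ω := hqω _ (heq ▸ he)
    have hv'R : v' ∈ dualRectangle M N := hQs _ (hqs _ q.end_mem_support)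
    rcases hua.isAboveFace_or_mem_of_adj huv' hv'R with h' | h'
    · exact hna h'
    · have hopen : sepEdge v' u ∈ ω :=
        mem_of_adj_dualBelowR hω h' hua.mem_dualRectangle hua.not_mem_dualBelowR huv'.symm
      rw [sepEdge_comm] at hopen
      exact ZdDual.sepEdge_not_mem_of_mem_dualConfig huv' hdual hopen

/-! ### Small walk lemmas -/

/-- Vertices of `p.take k` are vertices `p.getVert m`, `m ≤ k`. [folklore] -/
theorem exists_getVert_of_mem_support_take {V : Type*} {G : SimpleGraph V} {u v : V} (p : G.Walk u v)
    (k : ℕ) {z : V} (hz : z ∈ (p.take k).support) : ∃ m, m ≤ k ∧ m ≤ p.length ∧ p.getVert m = z := by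
  obtain ⟨n, hn, hnl⟩ := Walk.mem_support_iff_exists_getVert.1 hz
  rw [Walk.take_getVert] at hn
  rw [Walk.take_length] at hnl
  exact ⟨min k n, min_le_left _ _, by omega, hn⟩

/-- Vertices of `p.drop k` (`k ≤ length`) are vertices `p.getVert m`, `k ≤ m ≤ length`. [folklore] -/
theorem exists_getVert_of_mem_support_drop {V : Type*} {G : SimpleGraph V} {u v : V} (p : G.Walk u v)
    {k : ℕ} (hk : k ≤ p.length) {z : V} (hz : z ∈ (p.drop k).support) :
    ∃ m, k ≤ m ∧ m ≤ p.length ∧ p.getVert m = z := by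
  obtain ⟨n, hn, hnl⟩ := Walk.mem_support_iff_exists_getVert.1 hz
  rw [Walk.drop_getVert] at hn
  rw [Walk.drop_length] at hnl
  exact ⟨k + n, by omega, by omega, hn⟩

/-- Edges of `p.take k` are edges of `p`. [folklore] -/
theorem edges_take_subset {V : Type*} {G : SimpleGraph V} {u v : V} (p : G.Walk u v) (k : ℕ) :
    (p.take k).edges ⊆ p.edges := by
  rw [Walk.edges_take]; exact List.take_subset _ _

/-- Edges of `p.drop k` are edges of `p`. [folklore] -/
theorem edges_drop_subset {V : Type*} {G : SimpleGraph V} {u v : V} (p : G.Walk u v) (k : ℕ) :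
    (p.drop k).edges ⊆ p.edges := by
  rw [Walk.edges_drop]; exact List.drop_subset _ _

/-- A face of a lattice edge is a face around each endpoint of the edge. [folklore] -/
theorem cornerFaces_of_mem_dualEdge {e : Sym2 (Site 2)} (he : e ∈ (zdGraph 2).edgeSet) {z f : Site 2}
    (hz : z ∈ e) (hf : f ∈ dualEdge e) : f ∈ cornerFaces z := by
  have hde : dualEdge e ∈ (zdGraph 2).edgeSet := dualEdge_mem_edgeSet_holds he
  generalize hg : dualEdge e = q at hde hf
  induction q using Sym2.ind with
  | h g g' =>
    have hgg' : (zdGraph 2).Adj g g' := hde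
    have heq : e = sepEdge g g' :=
      dualEdge_injOn_holds he (sepEdge_mem_edgeSet hgg') (by rw [hg, dualEdge_sepEdge hgg'])
    subst heq
    rcases Sym2.mem_iff.1 hf with rfl | rfl
    · exact (cornerFaces_of_mem_sepEdge hgg' hz).1
    · exact (cornerFaces_of_mem_sepEdge hgg' hz).2

/-- On a path, an edge of the path between the `i`-th and `j`-th vertices joins consecutive
indices. [folklore] -/
theorem eq_succ_or_eq_succ_of_mem_edges_path {V : Type*} {G : SimpleGraph V} {u v : V} (p : G.Walk u v)
    (hp : p.IsPath) {i j : ℕ} (hi : i ≤ p.length) (hj : j ≤ p.length)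
    (he : s(p.getVert i, p.getVert j) ∈ p.edges) : j = i + 1 ∨ i = j + 1 := by
  rw [Walk.edges, List.mem_map] at he
  obtain ⟨d, hd, hde⟩ := he
  obtain ⟨k, hk, hdk⟩ := List.getElem_of_mem hd
  have hk' : k < p.length := by rw [Walk.length_darts] at hk; exact hk
  rw [Walk.darts_getElem_eq_getVert k hk] at hdk
  subst hdk
  change s(p.getVert k, p.getVert (k + 1)) = s(p.getVert i, p.getVert j) at hde
  rcases Sym2.eq_iff.1 hde with ⟨h1, h2⟩ | ⟨h1, h2⟩
  · have := hp.getVert_injOn (by simp; omega) (by simp; omega) h1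
    have := hp.getVert_injOn (by simp; omega) (by simp; omega) h2
    omega
  · have := hp.getVert_injOn (by simp; omega) (by simp; omega) h1
    have := hp.getVert_injOn (by simp; omega) (by simp; omega) h2
    omega

/-! ### Nolin's fifth arm: the last attachment before a dual foot has a dual foot -/

/-- **The fifth arm** (Nolin 2008, proof of Thm. 24 (ii): "consider the last vertex `v` before
`v₂` that is connected to the top side: it is not hard to see that there is a white arm from `v`
to the top side"), bond-`ℤ²` form. Let `π` be the lowest crossing of `R` (a simple left–right path
whose edges are the low edges), `i < j` indices with an attachment at `π i`, a dual foot at `π j`,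
and no attachment at `π k` for `i < k ≤ j`. Then `π i` has a dual foot. PROOF (the bond rendering of `LowSeq.isFootK_of_gap`, `FiveArmSite.lean`):
by planar duality for the configuration `footConfig M N ω (π i)` either its dual has a top–bottom
crossing — which yields the dual foot (`hasDualFootAt_of_dualTBCrossing`) — or it has an open
left–right crossing `ν`, which avoids `π i` and runs through above vertices and vertices of `π`.
The latter is impossible: `ν` passes through `π j` (`mem_support_of_hasDualFootAt`) and meets the
open tentacle `U` attaching the top side to `π i` (mixed crossing lemma); but walking along `ν`
from that meeting point one stays in the set of vertices `π k`, `k < i`, and of above vertices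
whose open above-cluster has no open edge to any `π k`, `k > i` (a chord or an arch of `ν` over
`π i` would have to meet `U`, by the mixed crossing lemma again; an attachment of the cluster of
`U` beyond `j` would give an open left–right crossing avoiding the pivotal vertex `π j`), a set
not containing `π j`. [cite: Nolin2008, §5.2, proof of Thm. 24 (ii) (arXiv 0711.4948: Thm. 23 (ii), p. 17)] -/
theorem hasDualFootAt_of_gap (hω : ω ⊆ (zdGraph 2).edgeSet) (hM : 1 ≤ M)
    (hT : ∀ t ∈ dualTopSide M N, t ∉ dualBelowR M N ω)
    {a b : Site 2} (π : (zdGraph 2).Walk a b) (hπ : π.IsPath)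
    (hends : (a 0 = 0 ∧ b 0 = M) ∨ (a 0 = M ∧ b 0 = 0))
    (hR : ∀ z ∈ π.support, z ∈ rectangle M N) (hE : ∀ e, e ∈ π.edges ↔ IsLowEdge M N ω e)
    {i j : ℕ} (hij : i < j) (hj : j ≤ π.length)
    (hi : IsAttachedLow M N ω (π.getVert i)) (hjD : HasDualFootAt M N ω (π.getVert j))
    (hgap : ∀ k, i < k → k ≤ j → ¬ IsAttachedLow M N ω (π.getVert k)) :
    HasDualFootAt M N ω (π.getVert i) := by
  classical
  -- preliminaries on `π`
  have hiL : i ≤ π.length := hij.le.trans hj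
  have hnil : ¬ π.Nil := by
    intro h; have := h.eq; subst this
    rcases hends with ⟨h1, h2⟩ | ⟨h1, h2⟩ <;> omega
  have hsupp : ∀ z, z ∈ π.support ↔ IsLowVertex M N ω z := by
    intro z
    rw [Walk.mem_support_iff_exists_mem_edges_of_not_nil hnil]
    exact ⟨fun ⟨e, he, hze⟩ => ⟨e, (hE e).1 he, hze⟩, fun ⟨e, he, hze⟩ => ⟨e, (hE e).2 he, hze⟩⟩
  have hinj : ∀ {m n : ℕ}, m ≤ π.length → n ≤ π.length → π.getVert m = π.getVert n → m = n :=
    fun hm hn h => hπ.getVert_injOn hm hn h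
  have hπω : ∀ e ∈ π.edges, e ∈ ω := fun e he => ((hE e).1 he).mem hω
  have hAboveNot : ∀ {z : Site 2}, IsAboveVertex M N ω z → z ∉ π.support :=
    fun hz hzs => hz.2.1 ((hsupp _).1 hzs)
  have hR' : ∀ z ∈ π.support, 0 ≤ z 0 ∧ z 0 ≤ M ∧ 0 ≤ z 1 ∧ z 1 ≤ N := fun z hz =>
    mem_rectangle_iff.1 (hR z hz)
  have hκR : ∀ m, π.getVert m ∈ rectangle M N := fun m => hR _ (π.getVert_mem_support m)
  have hκi_low : IsLowVertex M N ω (π.getVert i) := (hsupp _).1 (π.getVert_mem_support i)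
  have hκj_low : IsLowVertex M N ω (π.getVert j) := (hsupp _).1 (π.getVert_mem_support j)
  -- the above-open connection
  set Ab : Set (Site 2) := {z | IsAboveVertex M N ω z} with hAb
  -- the attachment at `π i`: the tentacle `U' : t₀ → t → π i`
  obtain ⟨t, ⟨t₀, ht₀, U, hUa, hUe⟩, hti, htiω⟩ := hi
  have ht₀1 : t₀ 1 = N := (Finset.mem_filter.1 ht₀).2
  set U' : (zdGraph 2).Walk t₀ (π.getVert i) := U.concat hti with hU'
  have hU's : ∀ z ∈ U'.support, 0 ≤ z 0 ∧ z 0 ≤ M ∧ 0 ≤ z 1 ∧ z 1 ≤ N := by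
    intro z hz
    rw [hU', Walk.support_concat, List.mem_append, List.mem_singleton] at hz
    rcases hz with hz | rfl
    · exact mem_rectangle_iff.1 (hUa z hz).1
    · exact mem_rectangle_iff.1 (hκR i)
  have hUconn : ∀ z ∈ U.support, ω ∈ openConnIn Ab t z := by
    intro z hz
    have h1 := mem_openConnIn_of_walk (ω := ω) (S := Ab) (U.dropUntil z hz)
      (fun w hw => hUa w (U.support_dropUntil_subset_support hz hw))
      (fun e he => hUe e (U.edges_dropUntil_subset_edges hz he))
    rwa [openConnIn_comm] at h1
  have hTop : ∀ {w : Site 2}, ω ∈ openConnIn Ab t w → IsTopJoinedAbove M N ω w := by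
    intro w hw
    obtain ⟨W, hWs, hWe⟩ := exists_walk_of_mem_openConnIn hω hw
    exact IsTopJoinedAbove.of_walk ⟨t₀, ht₀, U, hUa, hUe⟩ W hWs hWe
  -- the drop at `π i`: a face below around `π i` and its dual-open walk to the bottom face row
  obtain ⟨g, hg, hgB⟩ := hκi_low.exists_cornerFace_mem
  obtain ⟨b'', hb'', hconnD⟩ := exists_openConnIn_dualBelowR hgB
  obtain ⟨D', hD's, hD'e⟩ :=
    exists_walk_of_mem_openConnIn (fun _ h => h.1 : dualConfig ω ⊆ (zdGraph 2).edgeSet) hconnD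
  set D : (zdGraph 2).Walk g b'' := D'.reverse with hD
  have hb''1 : b'' 1 = -1 := (Finset.mem_filter.1 hb'').2
  have hDs : ∀ z ∈ D.support, 0 ≤ z 0 ∧ z 0 + 1 ≤ M ∧ -1 ≤ z 1 ∧ z 1 ≤ N := by
    intro z hz
    rw [hD, Walk.support_reverse, List.mem_reverse] at hz
    have := mem_dualRectangle_iff.1 (dualBelowR_subset (Finset.mem_coe.1 (hD's z hz)))
    omega
  have hDclosed : ∀ d ∈ D.darts, sepEdge d.fst d.snd ∉ ω := by
    intro d hd
    rw [hD, Walk.darts_reverse, List.mem_reverse, List.mem_map] at hd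
    obtain ⟨d', hd', rfl⟩ := hd
    rw [show (d'.symm).fst = d'.snd from rfl, show (d'.symm).snd = d'.fst from rfl, sepEdge_comm]
    exact ZdDual.sepEdge_not_mem_of_mem_dualConfig d'.adj
      (hD'e _ (by rw [Walk.edges]; exact List.mem_map.2 ⟨d', hd', rfl⟩))
  -- THE MIXED CROSSING LEMMA at `π i`: an open left–right walk of `R` meets the tentacle
  have mixed : ∀ {a' b' : Site 2} (P : (zdGraph 2).Walk a' b'), (∀ z ∈ P.support, z ∈ rectangle M N) →
      ((a' 0 = 0 ∧ b' 0 = M) ∨ (a' 0 = M ∧ b' 0 = 0)) → (∀ e ∈ P.edges, e ∈ ω) →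
      ∃ z ∈ P.support, z ∈ U.support ∨ z = π.getVert i := by
    intro a' b' P hPs hPends hPω
    obtain ⟨z, hz, hzU⟩ := exists_mem_support_of_mixedCrossing_of_ends P U' D
      (fun z hz => mem_rectangle_iff.1 (hPs z hz)) hU's hDs hPends ht₀1 hg hb''1
      (fun d hd he => hDclosed d hd (hPω _ he))
    refine ⟨z, hz, ?_⟩
    rw [hU', Walk.support_concat, List.mem_append, List.mem_singleton] at hzU
    exact hzU
  -- KEY: the above-cluster of `t` has no open edge to `π k`, `k > i`
  have key : ∀ {w : Site 2}, ω ∈ openConnIn Ab t w → ∀ k, i < k → k ≤ π.length →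
      ¬ ((zdGraph 2).Adj w (π.getVert k) ∧ s(w, π.getVert k) ∈ ω) := by
    intro w hw k hik hkL ⟨hadj, hopen⟩
    have hatt : IsAttachedLow M N ω (π.getVert k) := ⟨w, hTop hw, hadj, hopen⟩
    rcases le_or_gt k j with hkj | hjk
    · exact hgap k hik hkj hatt
    · -- an open left–right walk avoiding `π j`: `π[0,i] + (π i → t ⇝ w → π k) + π[k,L]`
      obtain ⟨W, hWs, hWe⟩ := exists_walk_of_mem_openConnIn hω hw
      set A : (zdGraph 2).Walk (π.getVert i) (π.getVert k) :=
        Walk.cons hti.symm (W.concat hadj) with hA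
      set μ : (zdGraph 2).Walk a b := (π.take i).append (A.append (π.drop k)) with hμ
      have hμs : ∀ z ∈ μ.support, z ∈ rectangle M N := by
        intro z hz
        rw [hμ, Walk.mem_support_append_iff, Walk.mem_support_append_iff, hA, Walk.support_cons,
          List.mem_cons, Walk.support_concat, List.mem_append, List.mem_singleton] at hz
        rcases hz with hz | (rfl | (hz | rfl)) | hz
        · obtain ⟨m, -, -, rfl⟩ := exists_getVert_of_mem_support_take π i hz; exact hκR m
        · exact hκR i
        · exact (hWs z hz).1
        · exact hκR k
        · obtain ⟨m, -, -, rfl⟩ := exists_getVert_of_mem_support_drop π hkL hz; exact hκR m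
      have hμe : ∀ e ∈ μ.edges, e ∈ ω := by
        intro e he
        rw [hμ, Walk.edges_append, List.mem_append, Walk.edges_append, List.mem_append, hA,
          Walk.edges_cons, List.mem_cons, Walk.edges_concat, List.concat_eq_append, List.mem_append,
          List.mem_singleton] at he
        rcases he with he | (rfl | (he | rfl)) | he
        · exact hπω e (edges_take_subset π i he)
        · rw [Sym2.eq_swap]; exact htiω
        · exact hWe e he
        · exact hopen
        · exact hπω e (edges_drop_subset π k he)
      have hjμ : π.getVert j ∈ μ.support :=
        mem_support_of_hasDualFootAt μ hμs hends hμe hκj_low (hκR j) hjD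
      rw [hμ, Walk.mem_support_append_iff, Walk.mem_support_append_iff, hA, Walk.support_cons,
        List.mem_cons, Walk.support_concat, List.mem_append, List.mem_singleton] at hjμ
      rcases hjμ with hz | (h | (hz | h)) | hz
      · obtain ⟨m, hmi, hmL, hm⟩ := exists_getVert_of_mem_support_take π i hz
        have := hinj hmL hj hm; omega
      · have := hinj hj hiL h; omega
      · exact hAboveNot (hWs _ hz) (π.getVert_mem_support j)
      · have := hinj hj hkL h; omega
      · obtain ⟨m, hkm, hmL, hm⟩ := exists_getVert_of_mem_support_drop π hkL hz
        have := hinj hmL hj hm; omega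
  -- planar duality for `footConfig`
  rcases lrCrossing_xor_dualTBCrossing_holds M N ((footConfig_subset _).trans hω) with ⟨hlr, -⟩ | ⟨hdual, -⟩
  swap
  · exact hasDualFootAt_of_dualTBCrossing hω hT hdual
  exfalso
  -- (a) the open left–right walk `ν` of `footConfig`
  obtain ⟨l, hl, r, hr, hconn⟩ := (mem_openCrossing_iff.1 hlr :)
  obtain ⟨ν, hνs, hνe⟩ := exists_walk_of_mem_openConnIn ((footConfig_subset _).trans hω) hconn
  have hl0 : l 0 = 0 := (Finset.mem_filter.1 (Finset.mem_coe.1 hl)).2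
  have hrM : r 0 = M := (Finset.mem_filter.1 (Finset.mem_coe.1 hr)).2
  have hνR : ∀ z ∈ ν.support, z ∈ rectangle M N := fun z hz => Finset.mem_coe.1 (hνs z hz)
  have hνω : ∀ e ∈ ν.edges, e ∈ ω := fun e he => footConfig_subset _ (hνe e he)
  have hνnil : ¬ ν.Nil := by
    intro h; have := h.eq; subst this; omega
  -- `ν` avoids `π i`; its vertices are above vertices or vertices of `π`
  have hνi : π.getVert i ∉ ν.support := by
    intro h
    obtain ⟨e, he, hie⟩ := (Walk.mem_support_iff_exists_mem_edges_of_not_nil hνnil).1 h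
    exact (hνe e he).2.2 hie
  have hνab : ∀ z ∈ ν.support, IsAboveVertex M N ω z ∨ z ∈ π.support := by
    intro z hz
    obtain ⟨e, he, hze⟩ := (Walk.mem_support_iff_exists_mem_edges_of_not_nil hνnil).1 hz
    obtain ⟨heω, ⟨f, hf, hfa⟩, -⟩ := hνe e he
    have hfc : f ∈ cornerFaces z := cornerFaces_of_mem_dualEdge (hω heω) hze hf
    by_cases hlow : IsLowVertex M N ω z
    · exact Or.inr ((hsupp z).2 hlow)
    · exact Or.inl ⟨hνR z hz, hlow, f, hfc, hfa⟩
  -- (a1) `ν` passes through `π j`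
  have hνj : π.getVert j ∈ ν.support :=
    mem_support_of_hasDualFootAt ν hνR (Or.inl ⟨hl0, hrM⟩) hνω hκj_low (hκR j) hjD
  -- (a2) `ν` meets the tentacle at an above vertex `z₀ ∈ U`
  obtain ⟨z₀, hz₀ν, hz₀U⟩ := mixed ν hνR (Or.inl ⟨hl0, hrM⟩) hνω
  have hz₀U' : z₀ ∈ U.support := by
    rcases hz₀U with h | rfl
    · exact h
    · exact absurd hz₀ν hνi
  -- (a3) the invariant set
  set Sg : Set (Site 2) := {w | (∃ k, k < i ∧ π.getVert k = w) ∨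
    (IsAboveVertex M N ω w ∧ ∀ w', ω ∈ openConnIn Ab w w' → ∀ k, i < k → k ≤ π.length →
      ¬ ((zdGraph 2).Adj w' (π.getVert k) ∧ s(w', π.getVert k) ∈ ω))} with hSg
  have hz₀Sg : z₀ ∈ Sg := by
    refine Or.inr ⟨hUa z₀ hz₀U', fun w' hw' k hik hkL => key ?_ k hik hkL⟩
    exact PlanarDuality.openConnIn_trans (hUconn z₀ hz₀U') hw'
  -- one step along `ν`
  have step : ∀ x y : Site 2, x ∈ Sg → (zdGraph 2).Adj x y → s(x, y) ∈ footConfig M N ω (π.getVert i) →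
      y ∈ ν.support → y ∈ Sg := by
    intro x y hx hxy hexy hyν
    have hyi : y ≠ π.getVert i := fun h => hνi (h ▸ hyν)
    have hxyω : s(x, y) ∈ ω := hexy.1
    rcases hx with ⟨k, hki, rfl⟩ | ⟨hxa, hxc⟩
    · -- `x = π k`, `k < i`
      have hkL : k ≤ π.length := by omega
      rcases hνab y hyν with hya | hyπ
      · -- `y` above: no arch from `y` over `π i`
        refine Or.inr ⟨hya, fun w' hyw' k'' hik'' hk''L ⟨hadj', hopen'⟩ => ?_⟩
        obtain ⟨Wy, hWys, hWye⟩ := exists_walk_of_mem_openConnIn hω hyw'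
        set A : (zdGraph 2).Walk (π.getVert k) (π.getVert k'') := Walk.cons hxy (Wy.concat hadj') with hA
        set P'' : (zdGraph 2).Walk a b := (π.take k).append (A.append (π.drop k'')) with hP''
        have hP''s : ∀ z ∈ P''.support, z ∈ rectangle M N := by
          intro z hz
          rw [hP'', Walk.mem_support_append_iff, Walk.mem_support_append_iff, hA, Walk.support_cons,
            List.mem_cons, Walk.support_concat, List.mem_append, List.mem_singleton] at hz
          rcases hz with hz | (rfl | (hz | rfl)) | hz
          · obtain ⟨m, -, -, rfl⟩ := exists_getVert_of_mem_support_take π k hz; exact hκR m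
          · exact hκR k
          · exact (hWys z hz).1
          · exact hκR k''
          · obtain ⟨m, -, -, rfl⟩ := exists_getVert_of_mem_support_drop π hk''L hz; exact hκR m
        have hP''e : ∀ e ∈ P''.edges, e ∈ ω := by
          intro e he
          rw [hP'', Walk.edges_append, List.mem_append, Walk.edges_append, List.mem_append, hA,
            Walk.edges_cons, List.mem_cons, Walk.edges_concat, List.concat_eq_append, List.mem_append,
            List.mem_singleton] at he
          rcases he with he | (rfl | (he | rfl)) | he
          · exact hπω e (edges_take_subset π k he)
          · exact hxyω
          · exact hWye e he
          · exact hopen'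
          · exact hπω e (edges_drop_subset π k'' he)
        obtain ⟨z, hzP, hzU⟩ := mixed P'' hP''s hends hP''e
        rw [hP'', Walk.mem_support_append_iff, Walk.mem_support_append_iff, hA, Walk.support_cons,
          List.mem_cons, Walk.support_concat, List.mem_append, List.mem_singleton] at hzP
        -- `z` is a vertex of `U` (an above vertex) or `π i`; locate it on `P''`
        rcases hzU with hzU | rfl
        · have hza : IsAboveVertex M N ω z := hUa z hzU
          rcases hzP with hz | (rfl | (hz | rfl)) | hz
          · obtain ⟨m, -, -, hm⟩ := exists_getVert_of_mem_support_take π k hz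
            exact hAboveNot hza (hm ▸ π.getVert_mem_support m)
          · exact hAboveNot hza (π.getVert_mem_support k)
          · -- `z` on the arch: the cluster of `t` reaches `w'`, contradiction with `key`
            have h1 : ω ∈ openConnIn Ab y z :=
              mem_openConnIn_of_walk (Wy.takeUntil z hz)
                (fun w hw => hWys w (Wy.support_takeUntil_subset_support hz hw))
                (fun e he => hWye e (Wy.edges_takeUntil_subset_edges hz he))
            have h2 : ω ∈ openConnIn Ab t w' :=
              PlanarDuality.openConnIn_trans (PlanarDuality.openConnIn_trans (hUconn z hzU)
                (by rw [openConnIn_comm]; exact h1)) hyw'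
            exact key h2 k'' hik'' hk''L ⟨hadj', hopen'⟩
          · exact hAboveNot hza (π.getVert_mem_support k'')
          · obtain ⟨m, -, -, hm⟩ := exists_getVert_of_mem_support_drop π hk''L hz
            exact hAboveNot hza (hm ▸ π.getVert_mem_support m)
        · rcases hzP with hz | (h | (hz | h)) | hz
          · obtain ⟨m, hmk, hmL, hm⟩ := exists_getVert_of_mem_support_take π k hz
            have := hinj hmL hiL hm; omega
          · have := hinj hiL hkL h; omega
          · exact hAboveNot (hWys _ hz) (π.getVert_mem_support i)
          · have := hinj hiL hk''L h; omega
          · obtain ⟨m, hkm, hmL, hm⟩ := exists_getVert_of_mem_support_drop π hk''L hz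
            have := hinj hmL hiL hm; omega
      · -- `y = π k'`
        obtain ⟨k', hk', hk'L⟩ := Walk.mem_support_iff_exists_getVert.1 hyπ
        subst hk'
        have hk'i : k' ≠ i := fun h => hyi (h ▸ rfl)
        by_cases hedge : s(π.getVert k, π.getVert k') ∈ π.edges
        · rcases eq_succ_or_eq_succ_of_mem_edges_path π hπ hkL hk'L hedge with h | h
          · exact Or.inl ⟨k', by omega, rfl⟩
          · exact Or.inl ⟨k', by omega, rfl⟩
        · -- a chord of `π`
          rcases lt_or_gt_of_ne hk'i with hlt | hgt
          · exact Or.inl ⟨k', hlt, rfl⟩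
          · exfalso
            set P'' : (zdGraph 2).Walk a b :=
              (π.take k).append (Walk.cons hxy (π.drop k')) with hP''
            have hP''s : ∀ z ∈ P''.support, z ∈ rectangle M N := by
              intro z hz
              rw [hP'', Walk.mem_support_append_iff, Walk.support_cons, List.mem_cons] at hz
              rcases hz with hz | rfl | hz
              · obtain ⟨m, -, -, rfl⟩ := exists_getVert_of_mem_support_take π k hz; exact hκR m
              · exact hκR k
              · obtain ⟨m, -, -, rfl⟩ := exists_getVert_of_mem_support_drop π hk'L hz; exact hκR m
            have hP''e : ∀ e ∈ P''.edges, e ∈ ω := by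
              intro e he
              rw [hP'', Walk.edges_append, List.mem_append, Walk.edges_cons, List.mem_cons] at he
              rcases he with he | rfl | he
              · exact hπω e (edges_take_subset π k he)
              · exact hxyω
              · exact hπω e (edges_drop_subset π k' he)
            obtain ⟨z, hzP, hzU⟩ := mixed P'' hP''s hends hP''e
            rw [hP'', Walk.mem_support_append_iff, Walk.support_cons, List.mem_cons] at hzP
            rcases hzU with hzU | rfl
            · have hza : IsAboveVertex M N ω z := hUa z hzU
              rcases hzP with hz | rfl | hz
              · obtain ⟨m, -, -, hm⟩ := exists_getVert_of_mem_support_take π k hz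
                exact hAboveNot hza (hm ▸ π.getVert_mem_support m)
              · exact hAboveNot hza (π.getVert_mem_support k)
              · obtain ⟨m, -, -, hm⟩ := exists_getVert_of_mem_support_drop π hk'L hz
                exact hAboveNot hza (hm ▸ π.getVert_mem_support m)
            · rcases hzP with hz | h | hz
              · obtain ⟨m, hmk, hmL, hm⟩ := exists_getVert_of_mem_support_take π k hz
                have := hinj hmL hiL hm; omega
              · have := hinj hiL hkL h; omega
              · obtain ⟨m, hkm, hmL, hm⟩ := exists_getVert_of_mem_support_drop π hk'L hz
                have := hinj hmL hiL hm; omega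
    · -- `x` above, its cluster has no open edge to `π k`, `k > i`
      rcases hνab y hyν with hya | hyπ
      · refine Or.inr ⟨hya, fun w' hyw' => hxc w' ?_⟩
        exact PlanarDuality.openConnIn_trans (openConnIn_of_adj hxa hya hxyω hxy.ne) hyw'
      · obtain ⟨k', hk', hk'L⟩ := Walk.mem_support_iff_exists_getVert.1 hyπ
        subst hk'
        have hk'i : k' ≠ i := fun h => hyi (h ▸ rfl)
        rcases lt_or_gt_of_ne hk'i with hlt | hgt
        · exact Or.inl ⟨k', hlt, rfl⟩
        · exact absurd ⟨hxy, hxyω⟩ (hxc x (openConnIn_refl hxa) k' hgt hk'L)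
  -- propagation along sub-walks of `ν`
  have prop : ∀ {u₀ u₁ : Site 2} (W : (zdGraph 2).Walk u₀ u₁), (∀ z ∈ W.support, z ∈ ν.support) →
      (∀ e ∈ W.edges, e ∈ ν.edges) → u₀ ∈ Sg → ∀ z ∈ W.support, z ∈ Sg := by
    intro u₀ u₁ W
    induction W with
    | nil => intro _ _ h z hz; rw [Walk.support_nil, List.mem_singleton] at hz; rwa [hz]
    | cons hadj W' ih =>
      rename_i x y w
      intro hWs hWe hx z hz
      rw [Walk.support_cons, List.mem_cons] at hz
      rcases hz with rfl | hz
      · exact hx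
      · refine ih (fun u hu => hWs u (by simp [hu])) (fun e he => hWe e (by simp [he])) ?_ z hz
        exact step x y hx hadj (hνe _ (hWe _ (by simp))) (hWs y (by simp))
  -- `π j ∈ Sg`
  have hjSg : π.getVert j ∈ Sg := by
    have hsplit := ν.take_spec hz₀ν
    have : π.getVert j ∈ (ν.takeUntil z₀ hz₀ν).support ∨ π.getVert j ∈ (ν.dropUntil z₀ hz₀ν).support := by
      rw [← Walk.mem_support_append_iff, hsplit]; exact hνj
    rcases this with h | h
    · refine prop (ν.takeUntil z₀ hz₀ν).reverse (fun z hz => ?_) (fun e he => ?_) hz₀Sg _ (by simpa using h)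
      · exact ν.support_takeUntil_subset_support hz₀ν (by simpa using hz)
      · exact ν.edges_takeUntil_subset_edges hz₀ν (by simpa using he)
    · exact prop (ν.dropUntil z₀ hz₀ν) (fun z hz => ν.support_dropUntil_subset_support hz₀ν hz)
        (fun e he => ν.edges_dropUntil_subset_edges hz₀ν he) hz₀Sg _ h
  rcases hjSg with ⟨k, hki, hk⟩ | ⟨hja, -⟩
  · have := hinj (by omega) hj hk; omega
  · exact hAboveNot hja (π.getVert_mem_support j)

/-! ### A double foot: a vertex of the lowest crossing with an attachment and a dual foot -/

/-- **A double foot exists between an attachment and a later dual foot** (Nolin 2008, proof of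
Thm. 24 (ii): the site `v` of the lowest crossing with a black and a white arm to the top side):
take `i` the last attachment in `[f₁, f₂]` (`Nat.findGreatest`) and apply `hasDualFootAt_of_gap`
with `j = f₂`. [cite: Nolin2008, §5.2, proof of Thm. 24 (ii) (arXiv 0711.4948: Thm. 23 (ii), p. 17)] -/
theorem exists_doubleFoot_of_le (hω : ω ⊆ (zdGraph 2).edgeSet) (hM : 1 ≤ M)
    (hT : ∀ t ∈ dualTopSide M N, t ∉ dualBelowR M N ω)
    {a b : Site 2} (π : (zdGraph 2).Walk a b) (hπ : π.IsPath)
    (hends : (a 0 = 0 ∧ b 0 = M) ∨ (a 0 = M ∧ b 0 = 0))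
    (hR : ∀ z ∈ π.support, z ∈ rectangle M N) (hE : ∀ e, e ∈ π.edges ↔ IsLowEdge M N ω e)
    {f₁ f₂ : ℕ} (hf : f₁ ≤ f₂) (hf₂ : f₂ ≤ π.length)
    (h₁ : IsAttachedLow M N ω (π.getVert f₁)) (h₂ : HasDualFootAt M N ω (π.getVert f₂)) :
    ∃ i, f₁ ≤ i ∧ i ≤ f₂ ∧ IsAttachedLow M N ω (π.getVert i) ∧ HasDualFootAt M N ω (π.getVert i) := by
  classical
  set i : ℕ := Nat.findGreatest (fun k => IsAttachedLow M N ω (π.getVert k)) f₂ with hidef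
  have hf₁i : f₁ ≤ i := Nat.le_findGreatest hf h₁
  have hif₂ : i ≤ f₂ := Nat.findGreatest_le f₂
  have hiA : IsAttachedLow M N ω (π.getVert i) :=
    Nat.findGreatest_spec (P := fun k => IsAttachedLow M N ω (π.getVert k)) hf h₁
  have hmax : ∀ k, i < k → k ≤ f₂ → ¬ IsAttachedLow M N ω (π.getVert k) := fun k hik hkf =>
    Nat.findGreatest_is_greatest hik hkf
  refine ⟨i, hf₁i, hif₂, hiA, ?_⟩
  rcases eq_or_lt_of_le hif₂ with heq | hlt
  · rw [heq]; exact h₂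
  · exact hasDualFootAt_of_gap hω hM hT π hπ hends hR hE hlt hf₂ hiA h₂ hmax

/-- **A double foot exists between an attachment and a dual foot, in either order along the lowest
crossing** (apply `exists_doubleFoot_of_le` to the reversed path when the dual foot comes first).
[cite: Nolin2008, §5.2, proof of Thm. 24 (ii) (arXiv 0711.4948: Thm. 23 (ii), p. 17)] -/
theorem exists_doubleFoot (hω : ω ⊆ (zdGraph 2).edgeSet) (hM : 1 ≤ M)
    (hT : ∀ t ∈ dualTopSide M N, t ∉ dualBelowR M N ω)
    {a b : Site 2} (π : (zdGraph 2).Walk a b) (hπ : π.IsPath)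
    (hends : (a 0 = 0 ∧ b 0 = M) ∨ (a 0 = M ∧ b 0 = 0))
    (hR : ∀ z ∈ π.support, z ∈ rectangle M N) (hE : ∀ e, e ∈ π.edges ↔ IsLowEdge M N ω e)
    {f₁ f₂ : ℕ} (hf₁ : f₁ ≤ π.length) (hf₂ : f₂ ≤ π.length)
    (h₁ : IsAttachedLow M N ω (π.getVert f₁)) (h₂ : HasDualFootAt M N ω (π.getVert f₂)) :
    ∃ i, min f₁ f₂ ≤ i ∧ i ≤ max f₁ f₂ ∧ IsAttachedLow M N ω (π.getVert i) ∧
      HasDualFootAt M N ω (π.getVert i) := by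
  rcases le_or_gt f₁ f₂ with hf | hf
  · obtain ⟨i, h1, h2, hA, hD⟩ := exists_doubleFoot_of_le hω hM hT π hπ hends hR hE hf hf₂ h₁ h₂
    exact ⟨i, by rw [min_eq_left hf]; exact h1, by rw [max_eq_right hf]; exact h2, hA, hD⟩
  · -- reverse the path
    have hends' : (b 0 = 0 ∧ a 0 = M) ∨ (b 0 = M ∧ a 0 = 0) := by tauto
    have hR' : ∀ z ∈ π.reverse.support, z ∈ rectangle M N := fun z hz => hR z (by simpa using hz)
    have hE' : ∀ e, e ∈ π.reverse.edges ↔ IsLowEdge M N ω e := fun e => by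
      rw [Walk.edges_reverse, List.mem_reverse]; exact hE e
    have hlen : π.reverse.length = π.length := Walk.length_reverse π
    have hget : ∀ k, k ≤ π.length → π.reverse.getVert (π.length - k) = π.getVert k := by
      intro k hk
      rw [Walk.getVert_reverse]
      congr 1
      omega
    have h₁' : IsAttachedLow M N ω (π.reverse.getVert (π.length - f₁)) := by rw [hget f₁ hf₁]; exact h₁
    have h₂' : HasDualFootAt M N ω (π.reverse.getVert (π.length - f₂)) := by rw [hget f₂ hf₂]; exact h₂
    obtain ⟨i, h1, h2, hA, hD⟩ := exists_doubleFoot_of_le hω hM hT π.reverse hπ.reverse hends' hR' hE'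
      (f₁ := π.length - f₁) (f₂ := π.length - f₂) (by omega) (by rw [hlen]; omega) h₁' h₂'
    refine ⟨π.length - i, ?_, ?_, ?_, ?_⟩
    · rw [min_eq_right hf.le]; omega
    · rw [max_eq_left hf.le]; omega
    · have := hget (π.length - i) (by omega)
      rw [show π.length - (π.length - i) = i by omega] at this
      rw [← this]; exact hA
    · have := hget (π.length - i) (by omega)
      rw [show π.length - (π.length - i) = i by omega] at this
      rw [← this]; exact hD

end Literature.Probability.Percolation

end
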